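import Mathlib
import Summits.RiemannHypothesis.RiemannHypothesis.Theorems.WeilParityOffLineParityDetectionTorusGramIntegrals
import HarnessLib

/-!
# Entry bounds for the Gram matrices in the separated regime (helper file for stub TORUS-SEP)

Route `WeilParity`, crux `OffLineParityDetection` (item stmt-RiemannHypothesis-15431), line
`registered`, stub `stub_torusTopHeavySeparated` (TORUS-SEP).  Elementary real inequalities, no
zeta facts, no definitions.

With `h(ω) = (2η cos(ωa) + ω sin(ωa))/(4η²+ω²)` and `q(ω) = (ω cos(ωa) - 2η sin(ωa))/(4η²+ω²)`
(the half-line integrals of the file `…TorusGramIntegrals`), the Gram entries of the cosine / sine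
families at two absolute ordinates `g, h` are `CC = (h(g-h) + h(g+h))/2`,
`SS = (h(g-h) - h(g+h))/2`, `CS = (q(h-g) + q(h+g))/2`.  In the SEPARATED REGIME at the phase point
of the quarter window — all ordinates in `[Δ, γ⋆]`, distinct ones `Δ` apart, `η ≤ Δ`,
`2γ⋆a ≤ π/2`, `a > 0` — this file proves the sign structure and the size bounds fed into the
finite-dimensional core (`…TorusGramMatrix`): `SS ≥ 0`, `SS ≤ 1/Δ` off the diagonal,
`1/(4η) - 1/(4Δ) ≤ SS_gg ≤ 1/(4η) ≤ CC_gg`, `SS ≤ CC`, `SS_gg + a/π ≤ CC_gg`, `|CS| ≤ 1/Δ`,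
symmetry of `CC`; and the closing numerical inequality
`J²θ²(N + Jθ) < N u₀ (N - θ/4)` for `N = 1/(4η)`, `θ = 1/Δ`, `u₀ = 1/(4γ⋆)` when
`Δ² = 64 J² η γ⋆` and `64 J² η ≤ Δ`, `J ≥ 1`.

Everything is folklore and fully proved.
-/

set_option linter.dupNamespace false

noncomputable section

namespace Summit.RiemannHypothesis.RiemannHypothesis.Theorems.WeilParityOffLineParityDetection

/-! ## Values of the closed forms -/

/-- `h` is even. [folklore] -/
theorem torusSep_H_neg (η a ω : ℝ) :
    (2 * η * Real.cos (-ω * a) + -ω * Real.sin (-ω * a)) / (4 * η ^ 2 + (-ω) ^ 2) =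
      (2 * η * Real.cos (ω * a) + ω * Real.sin (ω * a)) / (4 * η ^ 2 + ω ^ 2) := by
  rw [neg_mul, Real.cos_neg, Real.sin_neg]
  ring

/-- `h(0) = 1/(2η)`. [folklore] -/
theorem torusSep_H_zero {η : ℝ} (hη : 0 < η) (a : ℝ) :
    (2 * η * Real.cos (0 * a) + 0 * Real.sin (0 * a)) / (4 * η ^ 2 + 0 ^ 2) = 1 / (2 * η) := by
  rw [zero_mul, Real.cos_zero]
  field_simp
  ring

/-- `q(0) = 0`. [folklore] -/
theorem torusSep_Q_zero (η a : ℝ) :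
    (0 * Real.cos (0 * a) - 2 * η * Real.sin (0 * a)) / (4 * η ^ 2 + 0 ^ 2) = 0 := by
  simp

/-! ## The entry bounds -/

section Bounds

variable {η a γs Δ : ℝ} {H Q : ℝ → ℝ}

/-- `h(g - h') = h(|g - h'|)`. [folklore] -/
theorem torusSep_H_sub_eq_abs
    (hH : ∀ ω, H ω = (2 * η * Real.cos (ω * a) + ω * Real.sin (ω * a)) / (4 * η ^ 2 + ω ^ 2))
    (g h : ℝ) : H (g - h) = H |g - h| := by
  rcases abs_choice (g - h) with e | e
  · rw [e]
  · rw [e, hH, hH, ← torusSep_H_neg η a (g - h)]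

/-- Window facts for a sum of two ordinates: `0 ≤ h(g + h') ` and `h(g + h') ≤ h(|g - h'|)`.
[folklore] -/
theorem torusSep_H_sum_window (hη : 0 < η) (ha : 0 < a) (hwin : 2 * γs * a ≤ Real.pi / 2)
    (hH : ∀ ω, H ω = (2 * η * Real.cos (ω * a) + ω * Real.sin (ω * a)) / (4 * η ^ 2 + ω ^ 2))
    {g h : ℝ} (hg0 : 0 ≤ g) (hg : g ≤ γs) (hh0 : 0 ≤ h) (hh : h ≤ γs) :
    0 ≤ H (g + h) ∧ H (g + h) ≤ H |g - h| := by
  have hsum : (g + h) * a ≤ Real.pi / 2 :=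
    le_trans (mul_le_mul_of_nonneg_right (by linarith) ha.le) hwin
  refine ⟨?_, ?_⟩
  · rw [hH]
    exact torusSep_closedForm_cos_nonneg hη ha.le (by linarith) hsum
  · rw [hH, hH]
    exact torusSep_closedForm_cos_antitone hη ha.le (abs_nonneg _) (abs_sub_le_iff.2
      ⟨by linarith, by linarith⟩) hsum

/-- (C1) **The sine Gram is entrywise non-negative**: `0 ≤ (h(g-h') - h(g+h'))/2`. [folklore] -/
theorem torusSep_SS_nonneg (hη : 0 < η) (ha : 0 < a) (hwin : 2 * γs * a ≤ Real.pi / 2)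
    (hH : ∀ ω, H ω = (2 * η * Real.cos (ω * a) + ω * Real.sin (ω * a)) / (4 * η ^ 2 + ω ^ 2))
    {g h : ℝ} (hg0 : 0 ≤ g) (hg : g ≤ γs) (hh0 : 0 ≤ h) (hh : h ≤ γs) :
    0 ≤ (H (g - h) - H (g + h)) / 2 := by
  have hw := torusSep_H_sum_window hη ha hwin hH hg0 hg hh0 hh
  rw [torusSep_H_sub_eq_abs hH]
  linarith [hw.2]

/-- **Off-diagonal sine entries are small**: `(h(g-h') - h(g+h'))/2 ≤ 1/Δ` when `|g - h'| ≥ Δ`,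
`g, h' ≥ Δ > 0`. [folklore] -/
theorem torusSep_SS_le (hη : 0 < η) (hΔ : 0 < Δ)
    (hH : ∀ ω, H ω = (2 * η * Real.cos (ω * a) + ω * Real.sin (ω * a)) / (4 * η ^ 2 + ω ^ 2))
    {g h : ℝ} (hg : Δ ≤ g) (hh : Δ ≤ h) (hgh : Δ ≤ |g - h|) :
    (H (g - h) - H (g + h)) / 2 ≤ 1 / Δ := by
  have hne : g - h ≠ 0 := fun e ↦ by rw [e, abs_zero] at hgh; linarith
  have hpos : 0 < g + h := by linarith
  have h1 : |H (g - h)| ≤ 1 / Δ := by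
    rw [hH]
    refine (torusSep_abs_closedForm_cos_le hη hne a).trans ?_
    exact one_div_le_one_div_of_le hΔ hgh
  have h2 : |H (g + h)| ≤ 1 / Δ := by
    rw [hH]
    refine (torusSep_abs_closedForm_cos_le hη hpos.ne' a).trans ?_
    rw [abs_of_pos hpos]
    exact one_div_le_one_div_of_le hΔ (by linarith)
  have := abs_le.1 h1
  have := abs_le.1 h2
  linarith

/-- **Diagonal sine entries**: `1/(4η) - (1/Δ)/4 ≤ (h(0) - h(2g))/2 ≤ 1/(4η)` for `Δ ≤ g ≤ γ⋆`.
[folklore] -/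
theorem torusSep_SS_diag (hη : 0 < η) (ha : 0 < a) (hwin : 2 * γs * a ≤ Real.pi / 2) (hΔ : 0 < Δ)
    (hH : ∀ ω, H ω = (2 * η * Real.cos (ω * a) + ω * Real.sin (ω * a)) / (4 * η ^ 2 + ω ^ 2))
    {g : ℝ} (hg : Δ ≤ g) (hg' : g ≤ γs) :
    (H (g - g) - H (g + g)) / 2 ≤ 1 / (4 * η) ∧
      1 / (4 * η) - 1 / Δ / 4 ≤ (H (g - g) - H (g + g)) / 2 := by
  have h0 : H (g - g) = 1 / (2 * η) := by rw [sub_self, hH, torusSep_H_zero hη]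
  have hg0 : 0 ≤ g := by linarith
  have hw := torusSep_H_sum_window hη ha hwin hH hg0 hg' hg0 hg'
  have hpos : 0 < g + g := by linarith
  have h2 : |H (g + g)| ≤ 1 / (2 * Δ) := by
    rw [hH]
    refine (torusSep_abs_closedForm_cos_le hη hpos.ne' a).trans ?_
    rw [abs_of_pos hpos]
    exact one_div_le_one_div_of_le (by positivity) (by linarith)
  have := (abs_le.1 h2).2
  have e : 1 / (4 * η) = 1 / (2 * η) / 2 := by field_simp; ring
  have e' : 1 / Δ / 4 = 1 / (2 * Δ) / 2 := by field_simp; ring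
  rw [h0, e, e']
  constructor <;> linarith [hw.1]

/-- (C2) **`U = CC - SS ≥ 0` entrywise** and `CC_gg ≥ 1/(4η)`: `(h(g-h') - h(g+h'))/2 ≤
(h(g-h') + h(g+h'))/2`. [folklore] -/
theorem torusSep_SS_le_CC (hη : 0 < η) (ha : 0 < a) (hwin : 2 * γs * a ≤ Real.pi / 2)
    (hH : ∀ ω, H ω = (2 * η * Real.cos (ω * a) + ω * Real.sin (ω * a)) / (4 * η ^ 2 + ω ^ 2))
    {g h : ℝ} (hg0 : 0 ≤ g) (hg : g ≤ γs) (hh0 : 0 ≤ h) (hh : h ≤ γs) :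
    (H (g - h) - H (g + h)) / 2 ≤ (H (g - h) + H (g + h)) / 2 := by
  linarith [(torusSep_H_sum_window hη ha hwin hH hg0 hg hh0 hh).1]

/-- **Diagonal of `U`**: `(h(0) - h(2g))/2 + a/π ≤ (h(0) + h(2g))/2` (i.e. `h(2g) ≥ a/π`) for
`η ≤ Δ ≤ g ≤ γ⋆`, by Jordan's inequality. [folklore] -/
theorem torusSep_U_diag (hη : 0 < η) (ha : 0 < a) (hwin : 2 * γs * a ≤ Real.pi / 2)
    (hηΔ : η ≤ Δ)
    (hH : ∀ ω, H ω = (2 * η * Real.cos (ω * a) + ω * Real.sin (ω * a)) / (4 * η ^ 2 + ω ^ 2))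
    {g : ℝ} (hg : Δ ≤ g) (hg' : g ≤ γs) :
    (H (g - g) - H (g + g)) / 2 + a / Real.pi ≤ (H (g - g) + H (g + g)) / 2 ∧
      1 / (4 * η) ≤ (H (g - g) + H (g + g)) / 2 := by
  have hg0 : 0 ≤ g := by linarith
  have hsum : (g + g) * a ≤ Real.pi / 2 :=
    le_trans (mul_le_mul_of_nonneg_right (by linarith) ha.le) hwin
  have hlow := torusSep_closedForm_cos_ge hη ha.le (by linarith : 0 ≤ g + g) hsum
  rw [← hH] at hlow
  have hfrac : 1 / 2 ≤ (g + g) ^ 2 / (4 * η ^ 2 + (g + g) ^ 2) := by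
    rw [div_le_div_iff₀ two_pos (by positivity)]
    have hηg : η ≤ g := hηΔ.trans hg
    nlinarith [mul_le_mul hηg hηg hη.le (by linarith), hg, hη]
  have h1 : a / Real.pi ≤ H (g + g) := by
    refine le_trans ?_ hlow
    calc a / Real.pi = 2 * a / Real.pi * (1 / 2) := by ring
      _ ≤ 2 * a / Real.pi * ((g + g) ^ 2 / (4 * η ^ 2 + (g + g) ^ 2)) :=
          mul_le_mul_of_nonneg_left hfrac (by positivity)
      _ = _ := by ring
  have h0 : H (g - g) = 1 / (2 * η) := by rw [sub_self, hH, torusSep_H_zero hη]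
  have hw := torusSep_H_sum_window hη ha hwin hH hg0 hg' hg0 hg'
  have e : 1 / (4 * η) = 1 / (2 * η) / 2 := by field_simp; ring
  refine ⟨by linarith, ?_⟩
  rw [h0, e]
  linarith [hw.1]

/-- **The cross entries are small**: `|(q(h'-g) + q(h'+g))/2| ≤ 1/Δ` for `g, h' ≥ Δ > 0` with
`g = h'` or `|g - h'| ≥ Δ`. [folklore] -/
theorem torusSep_CS_le (hη : 0 < η) (hΔ : 0 < Δ)
    (hQ : ∀ ω, Q ω = (ω * Real.cos (ω * a) - 2 * η * Real.sin (ω * a)) / (4 * η ^ 2 + ω ^ 2))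
    {g h : ℝ} (hg : Δ ≤ g) (hh : Δ ≤ h) (hgh : g = h ∨ Δ ≤ |g - h|) :
    |(Q (h - g) + Q (h + g)) / 2| ≤ 1 / Δ := by
  have hpos : 0 < h + g := by linarith
  have h2 : |Q (h + g)| ≤ 1 / Δ := by
    rw [hQ]
    refine (torusSep_abs_closedForm_sin_le hη hpos.ne' a).trans ?_
    rw [abs_of_pos hpos]
    exact one_div_le_one_div_of_le hΔ (by linarith)
  have h1 : |Q (h - g)| ≤ 1 / Δ := by
    rcases hgh with e | hgh
    · rw [e, sub_self, hQ, torusSep_Q_zero, abs_zero]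
      positivity
    · have hne : h - g ≠ 0 := fun e ↦ by
        rw [show g - h = -(h - g) by ring, e, neg_zero, abs_zero] at hgh
        linarith
      rw [hQ]
      refine (torusSep_abs_closedForm_sin_le hη hne a).trans ?_
      rw [show |h - g| = |g - h| from abs_sub_comm h g]
      exact one_div_le_one_div_of_le hΔ hgh
  rw [abs_div, abs_two]
  have := abs_add_le (Q (h - g)) (Q (h + g))
  linarith

/-- **Symmetry of the cosine Gram**. [folklore] -/
theorem torusSep_CC_symm
    (hH : ∀ ω, H ω = (2 * η * Real.cos (ω * a) + ω * Real.sin (ω * a)) / (4 * η ^ 2 + ω ^ 2))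
    (g h : ℝ) : (H (g - h) + H (g + h)) / 2 = (H (h - g) + H (h + g)) / 2 := by
  rw [torusSep_H_sub_eq_abs hH g h, torusSep_H_sub_eq_abs hH h g, abs_sub_comm, add_comm g h]

end Bounds

/-! ## The closing numerical inequality -/

/-- **Closing inequality of Theorem SEP**: with `N = 1/(4η)`, `θ = 1/Δ`, `u₀ = 1/(4γ⋆)`,
`Δ² = 64J²ηγ⋆`, `64J²η ≤ Δ`, `J ≥ 1`: `J²θ²(N + Jθ) < N u₀ (N - θ/4)` (it reduces to
`4η(J+1) < 3Δ`). [folklore] -/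
theorem torusSep_closing {η γs Δ J : ℝ} (hη : 0 < η) (hγ : 0 < γs) (hΔ : 0 < Δ) (hJ : 1 ≤ J)
    (hΔsq : Δ ^ 2 = 64 * J ^ 2 * η * γs) (hΔη : 64 * J ^ 2 * η ≤ Δ) :
    J ^ 2 * (1 / Δ) ^ 2 * (1 / (4 * η) + J * (1 / Δ)) <
      1 / (4 * η) * (1 / (4 * γs)) * (1 / (4 * η) - 1 / Δ / 4) := by
  -- the reduced inequality `Δ + 4ηJ < 4(Δ - η)`, i.e. `4η(J+1) < 3Δ`
  have hJη : J * η ≤ J ^ 2 * η := by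
    have : J ≤ J ^ 2 := by nlinarith
    exact mul_le_mul_of_nonneg_right this hη.le
  have hJη0 : 0 < J * η := by positivity
  have hkey : Δ + 4 * η * J < 4 * (Δ - η) := by nlinarith
  -- eliminate `γ⋆` with `Δ² = 64J²ηγ⋆`
  have hg' : 1 / (4 * γs) = 16 * J ^ 2 * η / Δ ^ 2 := by
    rw [hΔsq]
    field_simp
    norm_num
  rw [hg']
  have hJ0 : 0 < J := by linarith
  rw [show J ^ 2 * (1 / Δ) ^ 2 * (1 / (4 * η) + J * (1 / Δ)) =
      J ^ 2 * (Δ + 4 * η * J) / (4 * η * Δ ^ 3) by field_simp,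
    show 1 / (4 * η) * (16 * J ^ 2 * η / Δ ^ 2) * (1 / (4 * η) - 1 / Δ / 4) =
      J ^ 2 * (Δ - η) / (η * Δ ^ 3) by field_simp; norm_num,
    div_lt_div_iff₀ (by positivity) (by positivity)]
  have hpos : 0 < J ^ 2 * η * Δ ^ 3 := by positivity
  nlinarith [mul_lt_mul_of_pos_left hkey hpos]

/-! ## Summary statement (the registered sub-goal of this helper file) -/

/-- **Entry bounds in the separated regime** (summary of this file, see the module docstring).
[folklore] -/
theorem torusSep_gramBounds :
    ∀ η a γs Δ : ℝ, 0 < η → 0 < a → 2 * γs * a ≤ Real.pi / 2 → 0 < Δ → η ≤ Δ →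
      ∀ H Q : ℝ → ℝ,
      (∀ ω, H ω = (2 * η * Real.cos (ω * a) + ω * Real.sin (ω * a)) / (4 * η ^ 2 + ω ^ 2)) →
      (∀ ω, Q ω = (ω * Real.cos (ω * a) - 2 * η * Real.sin (ω * a)) / (4 * η ^ 2 + ω ^ 2)) →
      ∀ g h : ℝ, Δ ≤ g → g ≤ γs → Δ ≤ h → h ≤ γs → (g = h ∨ Δ ≤ |g - h|) →
        0 ≤ (H (g - h) - H (g + h)) / 2 ∧
        (Δ ≤ |g - h| → (H (g - h) - H (g + h)) / 2 ≤ 1 / Δ) ∧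
        (H (g - g) - H (g + g)) / 2 ≤ 1 / (4 * η) ∧
        1 / (4 * η) - 1 / Δ / 4 ≤ (H (g - g) - H (g + g)) / 2 ∧
        (H (g - h) - H (g + h)) / 2 ≤ (H (g - h) + H (g + h)) / 2 ∧
        (H (g - g) - H (g + g)) / 2 + a / Real.pi ≤ (H (g - g) + H (g + g)) / 2 ∧
        1 / (4 * η) ≤ (H (g - g) + H (g + g)) / 2 ∧
        |(Q (h - g) + Q (h + g)) / 2| ≤ 1 / Δ ∧
        (H (g - h) + H (g + h)) / 2 = (H (h - g) + H (h + g)) / 2 := by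
  intro η a γs Δ hη ha hwin hΔ hηΔ H Q hH hQ g h hg hg' hh hh' hgh
  have hg0 : 0 ≤ g := by linarith
  have hh0 : 0 ≤ h := by linarith
  exact ⟨torusSep_SS_nonneg hη ha hwin hH hg0 hg' hh0 hh',
    fun hd ↦ torusSep_SS_le hη hΔ hH hg hh hd,
    (torusSep_SS_diag hη ha hwin hΔ hH hg hg').1, (torusSep_SS_diag hη ha hwin hΔ hH hg hg').2,
    torusSep_SS_le_CC hη ha hwin hH hg0 hg' hh0 hh',
    (torusSep_U_diag hη ha hwin hηΔ hH hg hg').1, (torusSep_U_diag hη ha hwin hηΔ hH hg hg').2,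
    torusSep_CS_le hη hΔ hQ hg hh hgh, torusSep_CC_symm hH g h⟩

end Summit.RiemannHypothesis.RiemannHypothesis.Theorems.WeilParityOffLineParityDetection

end
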